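import HarnessLib
import Summits.NavierStokesRegularity.NavierStokesRegularity.Theses.QuarterLogPincer

/-!
# LINE `limit_silence` (ns-idea-7 g12, line 3; lens «nearmiss», target «DSS wall») — crux
`QuarterLogPincer.TypeIQuantSubcubicExp` (stmt-NavierStokesRegularity-24077, LADDER-NS wall W7)

**No summit is proved by this line.**  Its target BY NAME is line `silencing_cost`'s ONLY stub that is not
a port of print, the critic-named NS-free statement **Sc′ `ThickBoxSilencingCost`**
(`stub_thickBoxSilencingCost` in `Lines/silencing_cost.lean` v1.1, commit 338118c44af2, §S; restated
VERBATIM below — workfile modules are not built on the farm, so «by name» = byte-identical restatement),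
which this file turns into a THEOREM `thickBoxSilencingCost_of_stubs` modulo three stubs of standard shape:

* L1a `stub_failingFamily : ¬ ThickBoxSilencingCost → FailingFamily` — NORMALISATION (parabolic rescaling
  `ω̃(s,z) = σ² ω(t + σ² s, y + σ z)` of the bad configurations that the negation provides at `K = Γ₂ + n`,
  `c = min δ (1/(n+1))`; pure calculus: chain rule for `fderiv`/`derivWithin`/`Δ`, change of variables in
  `∫⁻` over balls).  Size M (Lean calculus), certainly true.
* L1b `stub_limitWitness : FailingFamily → BackwardVanishingWitness` — COMPACTNESS (the one analytic step of
  the line): along the normalised failing family (`|ω̃ₙ| ≤ B`, `|∇ω̃ₙ| ≤ B`, `|∂ₛω̃ₙ − Δω̃ₙ| ≤ B(|ω̃ₙ| + |∇ω̃ₙ|)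
  ≤ 2B²` on `B(0, 2(Γ₂+n)) × [0,sₙ]`, `sₙ ∈ (0,1]`, `∫_{B_{Γ₂}}|ω̃ₙ(0)|² ≥ δ`, `∫_{B_{Γ₂+n}}|ω̃ₙ(sₙ)|² < 1/(n+1)`):
  (i) HÖLDER-⅓ EQUICONTINUITY IN TIME down to `s = 0` from the weak form + the Lipschitz bound
  (`|ω̃ₙ(s,x) − ω̃ₙ(s′,x)| ≤ 2Bη + |s−s′|·C(B)η⁻²`, `η = |s−s′|^{1/3}`), so `sₙ → 0` is IMPOSSIBLE (the final
  slice would converge locally uniformly to the initial one, whose mass on `B_{Γ₂}` is `≥ δ`); (ii) for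
  `sₙ → S > 0`: Arzelà–Ascoli on compacts (bounded + equi-Lipschitz + (i)) gives a jointly continuous bounded
  Lipschitz limit `ω*` on `[0,S] × ℝ³` with `∫_{B_{Γ₂}}|ω*(0)|² ≥ δ` and `ω*(S) ≡ 0`; Banach–Alaoglu gives
  `Fₙ := ∂ₛω̃ₙ − Δω̃ₙ ⇀* F` in `L^∞` and the heat equation `(∂ₛ − Δ)ω* = F` IN THE SENSE OF DISTRIBUTIONS on
  `(0,S) × ℝ³`; (iii) the interior `C^{1,α}` estimate for the heat operator with bounded right-hand side
  [Ladyzhenskaya–Solonnikov–Ural'tseva 1968 Ch. IV; Lieberman 1996 Ch. IV] makes `∇ω̃ₙ → ∇ω*` locally uniformly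
  on `(0,S) × ℝ³`, whence the a.e. bound `|F| ≤ B(|ω*| + |∇ω*|)` survives the weak-* limit.  Size M–L
  (bookkeeping; every ingredient in print).  Why it might fail: only by a bookkeeping slip — the class IS
  closed under these limits BECAUSE the source bound `2B²` feeds interior parabolic regularity (this corrects
  `NEARMISS-CENSUS-g12.md` row 73, which claimed the soft route unavailable for the inequality class).
* L2 `stub_noWitness : ¬ BackwardVanishingWitness` — BACKWARD UNIQUENESS, IN PRINT: a bounded, continuous,
  spatially Lipschitz distributional solution of `(∂ₛ − Δ)ω = F` on `(0,S) × ℝ³` with `|F| ≤ B(|ω| + |∇ω|)`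
  a.e. lies in `W^{2,1}_{2,loc}((0,S) × ℝ³)` (interior `L^q` theory of the heat operator, loc. cit.), so after
  the time reversal `s ↦ S − s` it satisfies (A.3.1)–(A.3.4) of [Seregin, Lecture Notes (2014), App. A.3,
  Thm 3.5 = Escauriaza–Seregin–Šverák 2003, ARMA 169, doi:10.1007/s00205-003-0263-8; vector-valued
  `u : Q₊ → ℝᵐ`, `|∂ₜu + Δu| ≤ c₁(|∇u| + |u|)`, `u(·,0) = 0`, growth `e^{M|x|²}`, `u, ∂ₜu, ∇u, ∇²u ∈ L²` on
  bounded subdomains; corpus:book:seregin2014-lecture-notes-regularity-theory-navier-stokes-equations PDF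
  pp. 145–146] on every half-space, hence `ω ≡ 0` on `(0,S) × ℝ³`, and by continuity `ω(0,·) ≡ 0` —
  contradicting the witness's non-vanishing at time `0`.  Size L as a port (Carleman inequalities), zero
  conjectural content.

KERNEL (proved, no sorry): `thickBoxSilencingCost_of : Normalisation → LimitStep → NoWitness → ThickBoxSilencingCost` (`Normalisation := ¬C → FailingFamily`, `LimitStep := FailingFamily → W`, `NoWitness := ¬W`;
by contradiction) and `thickBoxSilencingCost_of_stubs : ThickBoxSilencingCost`.

WHY THIS LINE (lens nearmiss).  Near-miss of record = `silencing_cost` v1.1 (idea-crit-4 g8 verdict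
pending; it paid idea-crit-7 g6's price P1 on `ember_census`): its stub Sc′ was defended by a SKETCHED
quantitative route (Gaussian-weighted Dirichlet quotient, constants not verbatim in print).  Measured deficit:
«constants sketched».  Single input improved here: NONE NEW IS NEEDED — the ESS backward-uniqueness theorem
(the near-miss theorem of the whole ember mechanism) already decides Sc′ by compactness, because Sc′ asks only
for the EXISTENCE of `K, c` (E2 `TerminalEmber` needs no rate).  So the chain
`R = TypeIQuantCubicExp ⟸ G2 + E1 + Sa + Sb + Sv + Sd + Sc′` (lines bead_census → ember_census →
silencing_cost, all kernels proved) now has Sc′ ⟸ L1a + L1b + L2 with L2 in print and L1a/L1b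
normalisation/compactness: modulo porting, the ember mechanism has NO conjectural stub left; what remains
conjectural toward R is exactly nothing on this branch — the open inputs are ports (G2 XL, E1 M, Sa M, Sv M,
Sd S, L1a M, L1b M–L, L2 L).  (That is a statement about THIS skeleton's stubs, each of which the critic may
strike; it is not a proof of R, let alone of any summit.)

WHY NOVEL vs listed routes/lines: no NS route or line in the tree uses a compactness–rigidity
(Kenig–Merle-shaped) closure of a LINEAR unique-continuation floor; `cubic_rung` (row 56) uses compactness
toward a LIOUVILLE theorem for ancient NS solutions (nonlinear, open), whereas here the rigid object is a
bounded caloric function with bounded lower-order terms vanishing at a finite time (linear, in print).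
Searched: `lean search 'backward uniqueness'` / `'BackwardUniqueness'` (tree: only docstring mentions in
Literature/Analysis/FluidPDE — no decl), corpus hybrid «backward uniqueness heat half space Carleman» →
[corpus:book:seregin2014 pp.145–149], «unique continuation parabolic lower order terms quantitative» →
[corpus:paper:arxiv-math_0611462 pp.3–4] (EFV 2006; quantitative, not needed here).

BEARS ON: W7 «R0-rate» `TypeIQuantCubicExp` (director id pending) through `silencing_cost` 338118c44af2 →
`ember_census` 65d69ceac529 → `bead_census` 1ed594923f4b, each by name.

CHEAPEST FALSIFIER: L1b/L2 die together iff a `BackwardVanishingWitness` EXISTS — i.e. a bounded, Lipschitz,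
non-trivial distributional solution of `|∂ₛω − Δω| ≤ B(|ω| + |∇ω|)` on `ℝ³ × (0,S)` vanishing identically
at `s = S`; Tychonoff's sideways solutions do vanish at a finite time but are UNBOUNDED (`≈ e^{c|x|^γ}`,
`γ > 2`), and bounded ones are excluded by ESS — so the falsifier reduces to finding an error in
[Seregin 2014, Thm 3.5].  For L1a: one rescaling identity failing in Lean (none can: it is the parabolic
scaling).  INSTRUMENT ROW (pub-ns-dss; proposal only, no job by this seat): none needed beyond
`silencing_cost`'s «silencing-floor» row — this line predicts its SUPPORT outcome (a positive floor
saturating in K) without predicting the floor's size.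

C0 (self-critic): Reduction 5 (Sc′ is four levels below the crux; L1b/L2 strictly weaker than Sc′: L2 is a
theorem in print, L1b is a compactness statement whose conclusion is (by L2) absurd, i.e. L1b ≡ ¬FailingFamily
≡ Sc′-normalised — so the CONTENT of Sc′ sits in L1b + L2 jointly, neither alone) · Attack 4 (named tools:
Arzelà–Ascoli, Banach–Alaoglu, LSU interior estimates, ESS Thm 3.5) · Lever 4 (problem-relative: first
linear compactness–rigidity closure on this crux; nearest = cubic_rung's nonlinear Liouville compactness)
· Barriers 4 (linear, scaling-free after normalisation; no ε-regularity, no profile at the apex; the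
Type-I / supercritical barriers do not quantify over caloric inequalities) · Killable 4 (L2 is checkable
against the printed theorem line by line; L1b's three ingredients are textbook).  BC7: see the card
(`Lines/limit-silence.md`): probes on `Normalisation`, `LimitStep`, `NoWitness` (and the objects `FailingFamily`,
`BackwardVanishingWitness`) vs the crux decl and, stub-free, vs `ThickBoxSilencingCost`.
-/

set_option linter.dupNamespace false

namespace Summit.NavierStokesRegularity.NavierStokesRegularity.Cruxes.TypeIQuantSubcubicExp.LimitSilence

noncomputable section

open MeasureTheory Set Function Filter Topology Metric
open scoped ENNReal NNReal Classical Laplacian RealInnerProductSpace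
open Literature.Analysis Literature.Analysis.FluidPDE

local notation "E3" => EuclideanSpace ℝ (Fin 3)

/-! ## §T  The target, restated verbatim -/

/-- TARGET BY NAME (restated VERBATIM from `…Cruxes.TypeIQuantSubcubicExp.SilencingCost.ThickBoxSilencingCost`,
tree `Lines/silencing_cost.lean` commit 338118c44af2, the critic-named NS-free form of idea-crit-7 g6's price
P1): COST OF SILENCING IN A THICK BOX for the parabolic-inequality class.  For every amplitude `B ≥ 1`,
initial enstrophy `δ > 0` and inner radius `Γ₂ ≥ 1` there are a thickness `K ≥ Γ₂` and a floor
`c ∈ (0, δ]` such that: any jointly smooth `ω` on `[t,t₁] × ℝ³`, `t < t₁ ≤ t + σ²`, obeying on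
`B(y,2Kσ) × [t,t₁]` the box bounds `‖ω‖ ≤ Bσ⁻²`, `‖∇ω‖ ≤ Bσ⁻³` and the differential inequality
`‖∂ₛω − Δω‖ ≤ Bσ⁻²‖ω‖ + Bσ⁻¹‖∇ω‖`, with `∫_{B(y,Γ₂σ)}‖ω(t)‖² ≥ δ/σ`, still has
`∫_{B(y,Kσ)}‖ω(t₁)‖² ≥ c/σ`. -/
def ThickBoxSilencingCost : Prop :=
  ∀ B δ Γ₂ : ℝ, 1 ≤ B → 0 < δ → 1 ≤ Γ₂ → ∃ K c : ℝ, Γ₂ ≤ K ∧ 0 < c ∧ c ≤ δ ∧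
    ∀ (ω : ℝ → E3 → E3) (y : E3) (σ t t₁ : ℝ), 0 < σ → t < t₁ → t₁ ≤ t + σ ^ 2 →
      IsSmoothSpaceTimeOn (Icc t t₁) ω →
      (∀ s ∈ Icc t t₁, ∀ x ∈ ball y (2 * K * σ),
        ‖ω s x‖ ≤ B * σ ^ (-(2 : ℝ)) ∧ ‖fderiv ℝ (ω s) x‖ ≤ B * σ ^ (-(3 : ℝ)) ∧
        ‖timeDerivWithin (Icc t t₁) ω s x - (Δ (ω s)) x‖ ≤
          B * σ ^ (-(2 : ℝ)) * ‖ω s x‖ + B * σ ^ (-(1 : ℝ)) * ‖fderiv ℝ (ω s) x‖) →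
      ENNReal.ofReal (δ / σ) ≤ ∫⁻ x in ball y (Γ₂ * σ), ‖ω t x‖ₑ ^ 2 →
      ENNReal.ofReal (c / σ) ≤ ∫⁻ x in ball y (K * σ), ‖ω t₁ x‖ₑ ^ 2

/-! ## §L  The limit objects -/

/-- The NORMALISED FAILING FAMILY (output of L1a, input of L1b): what the negation of
`ThickBoxSilencingCost` provides after the parabolic rescaling `ω̃(s,z) = σ² ω(t + σ² s, y + σ z)` — fixed
`B ≥ 1`, `δ > 0`, `Γ₂ ≥ 1` and, for every `n : ℕ`, a jointly smooth `ω` on `[0,s₁] × ℝ³` with span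
`0 < s₁ ≤ 1`, obeying the UNIT-SCALE box bounds and differential inequality on the growing ball
`B(0, 2(Γ₂+n)) × [0,s₁]`, with initial enstrophy `≥ δ` on `B(0,Γ₂)` and final enstrophy `< 1/(n+1)` on
`B(0, Γ₂+n)`. -/
def FailingFamily : Prop :=
  ∃ B δ Γ₂ : ℝ, 1 ≤ B ∧ 0 < δ ∧ 1 ≤ Γ₂ ∧ ∀ n : ℕ, ∃ (ω : ℝ → E3 → E3) (s₁ : ℝ), 0 < s₁ ∧ s₁ ≤ 1 ∧
    IsSmoothSpaceTimeOn (Icc 0 s₁) ω ∧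
    (∀ s ∈ Icc 0 s₁, ∀ x ∈ ball (0 : E3) (2 * (Γ₂ + n)),
      ‖ω s x‖ ≤ B ∧ ‖fderiv ℝ (ω s) x‖ ≤ B ∧
      ‖timeDerivWithin (Icc 0 s₁) ω s x - (Δ (ω s)) x‖ ≤ B * ‖ω s x‖ + B * ‖fderiv ℝ (ω s) x‖) ∧
    ENNReal.ofReal δ ≤ ∫⁻ x in ball (0 : E3) Γ₂, ‖ω 0 x‖ₑ ^ 2 ∧
    ∫⁻ x in ball (0 : E3) (Γ₂ + n), ‖ω s₁ x‖ₑ ^ 2 < ENNReal.ofReal (1 / ((n : ℝ) + 1))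

/-- A BACKWARD-VANISHING WITNESS (output of L1b, excluded by L2): constants `B ≥ 0`, `S > 0`, a vector
field `ω : ℝ → ℝ³ → ℝ³` and a source `F` such that `ω` is jointly continuous, bounded by `B`, `B`-Lipschitz
in space at every time; `F` is measurable with the unique-continuation bound
`‖F(s,x)‖ ≤ B (‖ω(s,x)‖ + ‖∇ω(s,x)‖)` for a.e. `(s,x)` with `s ∈ (0,S)` (`∇ω` = `fderiv`, which exists a.e.
by Rademacher); the heat equation `(∂ₛ − Δ)ω = F` holds IN THE SENSE OF DISTRIBUTIONS on `(0,S) × ℝ³`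
(tested against jointly smooth, compactly supported `φ` vanishing outside the time interval `(0,S)`:
`∫∫ ⟪ω, −∂ₛφ − Δφ⟫ = ∫∫ ⟪F, φ⟫`); `ω` VANISHES IDENTICALLY at time `S` and is NOT identically zero at
time `0`.  Backward uniqueness [ESS 2003; Seregin 2014 Thm 3.5] says no such object exists (L2). -/
def BackwardVanishingWitness : Prop :=
  ∃ (B S : ℝ) (ω F : ℝ → E3 → E3), 0 ≤ B ∧ 0 < S ∧
    Continuous (uncurry ω) ∧
    (∀ s x, ‖ω s x‖ ≤ B) ∧
    (∀ s, LipschitzWith (Real.toNNReal B) (ω s)) ∧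
    Measurable (uncurry F) ∧
    (∀ᵐ q : ℝ × E3, q.1 ∈ Ioo 0 S → ‖F q.1 q.2‖ ≤ B * (‖ω q.1 q.2‖ + ‖fderiv ℝ (ω q.1) q.2‖)) ∧
    (∀ φ : ℝ → E3 → E3, IsSmoothSpaceTimeOn univ φ → HasCompactSupport (uncurry φ) →
      (∀ s, s ∉ Ioo 0 S → ∀ x, φ s x = 0) →
      ∫ q : ℝ × E3, ⟪ω q.1 q.2, -(deriv (fun s => φ s q.2) q.1) - (Δ (φ q.1)) q.2⟫ =
        ∫ q : ℝ × E3, ⟪F q.1 q.2, φ q.1 q.2⟫) ∧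
    (∀ x, ω S x = 0) ∧ (∃ x, ω 0 x ≠ 0)

/-! ## §S  The three stub statements (named, so that BC7 probes and the critic address them by name) -/

/-- L1a statement: NORMALISATION — the negation of the target yields a normalised failing family. -/
def Normalisation : Prop := ¬ ThickBoxSilencingCost → FailingFamily

/-- L1b statement: COMPACTNESS — a normalised failing family yields a backward-vanishing witness. -/
def LimitStep : Prop := FailingFamily → BackwardVanishingWitness

/-- L2 statement: BACKWARD UNIQUENESS [ESS 2003; Seregin 2014 Thm 3.5] — no backward-vanishing witness. -/
def NoWitness : Prop := ¬ BackwardVanishingWitness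


/-- **L1a (stub, NORMALISATION; M, Lean calculus).**  The negation of `ThickBoxSilencingCost`, read at
`K := Γ₂ + n`, `c := min δ (1/(n+1))`, yields for every `n` a bad configuration `(ω, y, σ, t, t₁)`;
its parabolic rescaling `ω̃ s z := σ ^ 2 • ω (t + σ ^ 2 * s) (y + σ • z)` on `[0, (t₁−t)/σ²] × ℝ³` has unit-scale
bounds (`σ²·Bσ⁻² = B`, `σ³·Bσ⁻³ = B`, `(∂ₛ − Δ_z)ω̃ = σ⁴ (∂ₜ − Δₓ)ω`), initial mass `σ · (δ/σ) = δ` on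
`B(0,Γ₂)` and final mass `< σ · (c/σ) = c ≤ 1/(n+1)` on `B(0, Γ₂+n)` (change of variables `x = y + σ z`
in `∫⁻`, `dx = σ³ dz`, `‖σ²ω‖² = σ⁴‖ω‖²`).  Certainly true; chain rules for `fderiv`, `derivWithin`
(`timeDerivWithin`) and Mathlib's `Δ` under affine maps, `IsSmoothSpaceTimeOn` under affine maps, and
`MeasureTheory.lintegral` under `x ↦ y + σ • x`. -/
theorem stub_failingFamily : Normalisation := by
  sorry

/-- **L1b (stub, COMPACTNESS; M–L bookkeeping, the analytic step of the line).**  Along the normalised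
failing family: Hölder-⅓ equicontinuity in time down to `s = 0` (weak form + Lipschitz bound) rules out
`sₙ → 0`; for `sₙ → S > 0`, Arzelà–Ascoli (bounded, equi-Lipschitz, time-equicontinuous) + Banach–Alaoglu
for `Fₙ := ∂ₛω̃ₙ − Δω̃ₙ` (`|Fₙ| ≤ 2B²`) + the interior `C^{1,α}` estimate for the heat operator with bounded
source [LSU 1968 Ch. IV] (so `∇ω̃ₙ → ∇ω*` locally uniformly on `(0,S) × ℝ³` and the a.e. bound
`|F| ≤ B(|ω*| + |∇ω*|)` survives) produce a `BackwardVanishingWitness` (extended constantly in time outside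
`[0,S]`; `∫_{B_{Γ₂}}|ω*(0)|² ≥ δ > 0` gives the non-vanishing at `0`, `∫_{B_R}|ω*(S)|² = lim ≤ 1/(n+1) → 0`
the vanishing at `S`).  Why it might fail: a bookkeeping slip only; every ingredient is textbook. -/
theorem stub_limitWitness : LimitStep := by
  sorry

/-- **L2 (stub, BACKWARD UNIQUENESS — IN PRINT; L as a port).**  [Seregin, Lecture Notes on Regularity
Theory for the Navier–Stokes Equations (2014), App. A.3 Thm 3.5, PDF pp. 145–146 = Escauriaza–Seregin–Šverák,
ARMA 169 (2003), doi:10.1007/s00205-003-0263-8]: a vector-valued `u` on `ℝⁿ₊ × (0,1)` with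
`|∂ₜu + Δu| ≤ c₁(|∇u| + |u|)`, `u(·,0) = 0`, `|u| ≤ e^{M|x|²}` and `u, ∂ₜu, ∇u, ∇²u ∈ L²` on bounded
subdomains vanishes identically.  Applied after the time reversal `s ↦ S − s` on every half-space of `ℝ³`
to a `BackwardVanishingWitness` — which is in `W^{2,1}_{2,loc}((0,S) × ℝ³)` by the interior `L^q` theory of
the heat operator with bounded measurable source [LSU 1968 Ch. IV §9] and satisfies the inequality a.e. —
it gives `ω ≡ 0` on `(0,S) × ℝ³`, hence `ω(0,·) ≡ 0` by continuity: no witness exists. -/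
theorem stub_noWitness : NoWitness := by
  sorry

/-! ## §K  Kernel (proved) -/

/-- KERNEL: compactness–rigidity closure.  `ThickBoxSilencingCost` follows from the three stubs by
contradiction. -/
theorem thickBoxSilencingCost_of
    (h₁ : Normalisation) (h₂ : LimitStep) (h₃ : NoWitness) : ThickBoxSilencingCost := by
  by_contra h
  exact h₃ (h₂ (h₁ h))

/-- Sc′ of line `silencing_cost`, BY NAME (verbatim restatement), modulo L1a, L1b, L2. -/
theorem thickBoxSilencingCost_of_stubs : ThickBoxSilencingCost :=
  thickBoxSilencingCost_of stub_failingFamily stub_limitWitness stub_noWitness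

end

end Summit.NavierStokesRegularity.NavierStokesRegularity.Cruxes.TypeIQuantSubcubicExp.LimitSilence
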